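import Summits.QuantumFields.YangMills.Theorems.BalabanUVNodesSpineReadingOfRecord13CoPHKTower

/-!
# BalabanUVNodes ∕ node N19 (NE7) — THE `Core` DESCENT FROM THE v5 PIN TO A KEY READING: N19′'s face at dag-n20-d's spine reading of record `crOfRecord₁₃V` (full σ-packed
# histories) IMPLIES N19′'s face at the reading with a key-reading dial `crOfRecord₁₃KAt K₀ kr bd sh` for EVERY dial `kr` whose bad-key reading `bd` COVERS the record's
# persistence policy — same `δ`; the two honest cover instances (image flag ∕ policy wall); the located NON-instance (window dial + persistence flag below the floor)

Cell `pub-ymgap` (HUMAN RULING D-0062 Track A ∕ D-0149 width seats), WIDTH SEAT `pub-ymgap-dag-n19-w1` (node n19 = NE7, seat 1 of 3), generation g4, INTENT-4 (RESHAPED on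
dag-n20-d's «MINE ∕ GO» word, pub-ymgap INBOX 2026-08-28T07:44:08Z: key-space and reading objects are dag-n20-d's — `Node00/TwoRunSiteWindow` p608088, `…SpineReadingOfRecord13CoPHK`
p608328, `…KTower` p610265 — the `Core` transport is this seat's).  Route `Summits/QuantumFields/YangMills/Theses/BalabanUVNodes.lean`, key item K3⁷ `SpineGivenEndpointR13SepCoPH`
(stmt-QuantumFields-20544; v5 stub 2 `stub_expansion13H` pins `cr` to `crOfRecord₁₃V jc sh`; plan g83 WORDS-4 bookings (1)+(7) «re-key the core law at the window key»); filed
`--kind proof --supports … --as helper`.  COUNT-NEUTRAL.  THEOREMS ONLY (0 `def`, 0 `sorry`).  ADDITIVE — imports dag-n20-d's `…Theorems.BalabanUVNodesSpineReadingOfRecord13CoPHKTower`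
ONLY (through it `…SpineReadingOfRecord13CoPHK` — `classSetK₁₃ ∕ weightAK₁₃ ∕ weightBK₁₃ ∕ badClassK₁₃ ∕ crOfRecord₁₃KAt ∕ windowKeyReading₁₃`, `kr_mem_classSetK₁₃`, `mem_badClassK₁₃_iff`,
`weightAK₁₃_nonneg ∕ weightBK₁₃…`, `core_crOfRecord₁₃KAt`; `…SpineReadingOfRecord13CoPH(V)` — `classSet₁₃ ∕ weightA₁₃ ∕ weightB₁₃ ∕ badClass₁₃`; NODE 00's `TwoRunSiteWindow` —
`windowKeySigma`, `not_keyOldLargeField_windowKey`; `TwoRunSitePersistence` — `KeyOldLargeField`, `mem_badKeysSigma_iff`, `not_keyOldLargeField_zero`; and this seat's g2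
`…N19RekeyingCalculus` — `classVal_apply`, `classVal_sub_fun`, `core_classVal`); modifies nothing.  (The path name is the CLAIM's; the content is the descent.)

WHY.  Of the v6 move's kernel facts the KEY SPACE and the READING are in the tree (dag-n20-d); what was not is the one sentence the plan uses to compare v5 and a re-keyed v6:
«any proof of the v5 N19′ face still closes the re-keyed one» — and its LIMITS.  THIS FILE:
* §1 [folklore] `core_congr_decEq` · `classVal_congr_decEq` (`Core` ∕ `classVal` do not depend on the `DecidableEq` instance — lets statements keyed on `Classical.decEq (Σ …)` (v5,
  `crOfRecord₁₃KAt`) meet terms keyed on the Sigma-derived instance (`weightAK₁₃`'s body)) · `classVal_zero`.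
* §2 [bookkeeping] ★★ `core_keyReading_of_core_record` — for ANY dial `kr`, ANY bad-key reading `bd` COVERING the record's policy on the classes of record
  (`x ∈ badClass₁₃ … jcut K t → bd K (kr K x)`) and ANY shells: `Core 1 (F.side^4) classSet₁₃ (badClass₁₃ jcut) (weightA₁₃ − shA) (weightB₁₃ − shB) δ` ⇒
  `Core 1 (F.side^4) (classSetK₁₃ kr) (badClassK₁₃ kr bd) (weightAK₁₃ kr − classVal shA) (weightBK₁₃ kr − classVal shB) δ`, SAME `δ` (g2 `core_classVal` BY NAME) · `coreEdge_keyReading_of_coreEdge_record`.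
* §3 [bookkeeping] THE COVER CONDITION: ★ `cover_imageFlag` (the IMAGE flag `bd K u := ∃ x ∈ badClass₁₃ … jcut K 0, kr K x = u` always covers) · ★ `cover_of_cutZero` (policy wall
  `jcut = 0`: every `bd` covers) · ★★ `not_cover_window_persistence` (the WINDOW dial `windowKeySigma F c` with the PERSISTENCE flag `KeyOldLargeField (jcut ·)` and `jcut K ≤ c K`
  does NOT cover as soon as one class of record at step `K` carries an old large field at a level `≤ jcut K` — dag-n20-d's `not_keyOldLargeField_windowKey` BY NAME): the v5 face
  does NOT transport to «window key + persistence flag below the floor»; there the window-keyed face needs its own proof (this seat's class form p613310).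
* §4 [bookkeeping] ★★ `coreEdge_crOfRecord₁₃KAt_zeroShell_of_record` — AT THE READING: a v5-pin witness (zero shells) + cover + `weightA₁₃ ≥ 0` ⇒ the N19′ face-shape at
  `crOfRecord₁₃KAt K₀ kr bd 0` — `Core` at its carriers with ITS canonical `δ`, and that `δ` summable (dag-n20-d's `core_crOfRecord₁₃KAt` BY NAME) · ★ `coreEdge_windowReading_imageFlag_of_record`
  (the instance at the window dial of record `windowKeyReading₁₃ K₀ c` with the image flag).
READINGS (located; nothing proposed).  (i) For the plan's v5-vs-v6 comparison: with the IMAGE flag or in the policy-wall regime the re-keyed N19′ is WEAKER than v5's (same `δ`);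
with the persistence flag read AT the window key it is NOT implied (§3), i.e. a genuinely different stub — whose extra room is exactly the absorption of p610409 ∕ p613310.
(ii) Nothing here is Bałaban's; no estimate is proved.

HONEST FRAMING.  By-name bookkeeping over dag-n20-d's reading objects and this seat's g2 calculus; nothing of Bałaban's is asserted or instantiated; no estimate of the programme
is proved.  NE7 ∕ NE7b NOT PRINTED as two-run statements for d = 4 ∕ NOT proved; N19 ∕ N20 NOT discharged; K3⁷ OPEN, not claimed, v5 untouched; counts UNMOVED (typed 28∕28 ·
discharged 5∕27, A 5∕28).  Everything below is PROVED (0 `sorry`, 0 named facts, standard axioms); no decl carries a cite tag.  One finite four-torus programme at fixed ε — NOT ℝ⁴,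
NOT infinite volume, NOT OS, NOT a mass gap, NOT the Clay problem (R4 closes the conditional finite-𝕋⁴ rung `BalabanLadder.UV` only).
-/

noncomputable section

open Finset
open scoped BigOperators

namespace Summit.QuantumFields.YangMills.BalabanUVNodes.N19WindowTruncationKey

open Summit.QuantumFields.BalabanUV.T4Continuum.Spine.NE7 (Core)
open Literature.MathematicalPhysics.QuantumFieldTheory.Balaban1983to89
open Literature.MathematicalPhysics.QuantumFieldTheory.Balaban1983to89.T4Continuum
open Literature.MathematicalPhysics.QuantumFieldTheory.Balaban1983to89.Node00
open T4MatchingAssembly (classVal)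
open YMDAG.UVSplit
open Summit.QuantumFields.YangMills.BalabanUVNodes.N19RekeyingCalculus (classVal_apply classVal_sub_fun core_classVal)

/-! ## §1 Instance irrelevance and a zero lemma [folklore] -/

section Irrel
variable {σ ι : Type*}

/-- `Core` does not depend on the `DecidableEq` instance used for `T K ∖ Bad K t`. [folklore] -/
theorem core_congr_decEq (i₁ i₂ : DecidableEq ι) {l₀ vol : ℝ} {T : ℕ → Finset ι} {Bad : ℕ → ℝ → Finset ι} {P Q : ℕ → ℝ → ι → ℝ} {δ : ℕ → ℝ}
    (h : @Core ι i₁ l₀ vol T Bad P Q δ) : @Core ι i₂ l₀ vol T Bad P Q δ := by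
  have e : i₁ = i₂ := Subsingleton.elim _ _
  subst e
  exact h

/-- `classVal` does not depend on the `DecidableEq` instance used for its fibre filter. [folklore] -/
theorem classVal_congr_decEq (i₁ i₂ : DecidableEq ι) (S : ℕ → Finset σ) (π : ℕ → σ → ι) (b : ℕ → ℝ → σ → ℝ) :
    @classVal ι σ i₁ S π b = @classVal ι σ i₂ S π b := by
  have e : i₁ = i₂ := Subsingleton.elim _ _
  subst e
  rfl

/-- The re-keying of the zero family is zero. [folklore] -/
theorem classVal_zero [DecidableEq ι] (S : ℕ → Finset σ) (π : ℕ → σ → ι) (K : ℕ) (t : ℝ) (u : ι) :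
    classVal S π (fun _ _ _ => (0 : ℝ)) K t u = 0 := by
  rw [classVal_apply]
  exact Finset.sum_const_zero

end Irrel

/-! ## §2 The descent from the record's full key to any key reading [bookkeeping] -/

section Descent
variable {F : T4Family} {N : ℕ} [NeZero N] (θ : Stage13HParams F N) (hP : θ.Provisos₁₃CoPH F N) (K₀ : ℕ) (g₀ : ℕ → ℝ) (os : List (ULoop F))
  (kr : ℕ → (Σ K, SiteSeqKey F (K₀ + K)) → (Σ K, SiteSeqKey F (K₀ + K))) (bd : ℕ → (Σ K, SiteSeqKey F (K₀ + K)) → Prop) (jcut : ℕ → ℕ)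

/-- **★★ THE `Core` DESCENT FROM THE v5 PIN TO A KEY READING** [bookkeeping].  Let `kr` be ANY dial (per step, an endo-map of the σ-packed keys) and `bd` ANY bad-key reading that
COVERS the record's persistence policy on the classes of record: `x ∈ badClass₁₃ … jcut K t → bd K (kr K x)`.  If at the full key SOME `δ` gives
`Core 1 (F.side^4) classSet₁₃ (badClass₁₃ jcut) (weightA₁₃ − shA) (weightB₁₃ − shB) δ` (the v5 N19′ face's body at `crOfRecord₁₃VAt K₀ jcut sh`, any shells `shA, shB`), then at the
key reading the SAME `δ` gives `Core 1 (F.side^4) (classSetK₁₃ kr) (badClassK₁₃ kr bd) (weightAK₁₃ kr − classVal shA) (weightBK₁₃ kr − classVal shB) δ` — the fibre sums of the shells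
as the coarse shells (this seat's g2 `core_classVal` BY NAME, `hcover` from `kr_mem_classSetK₁₃` + `mem_badClassK₁₃_iff`). -/
theorem core_keyReading_of_core_record (shA shB : ℕ → ℝ → (Σ K, SiteSeqKey F (K₀ + K)) → ℝ) {δ : ℕ → ℝ}
    (h : letI : DecidableEq (Σ K, SiteSeqKey F (K₀ + K)) := Classical.decEq _
      Core 1 ((F.side : ℝ) ^ 4) (classSet₁₃ θ K₀ g₀) (badClass₁₃ θ K₀ g₀ jcut)
        (fun K t x => weightA₁₃ θ hP K₀ g₀ os K t x - shA K t x) (fun K t x => weightB₁₃ θ hP K₀ g₀ os K t x - shB K t x) δ)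
    (hcover : ∀ (K : ℕ) (t : ℝ), |t| ≤ 1 → ∀ x ∈ classSet₁₃ θ K₀ g₀ K, x ∈ badClass₁₃ θ K₀ g₀ jcut K t → bd K (kr K x)) :
    letI : DecidableEq (Σ K, SiteSeqKey F (K₀ + K)) := Classical.decEq _
    Core 1 ((F.side : ℝ) ^ 4) (classSetK₁₃ θ K₀ g₀ kr) (badClassK₁₃ θ K₀ g₀ kr bd)
      (fun K t u => weightAK₁₃ θ hP K₀ g₀ os kr K t u - classVal (classSet₁₃ θ K₀ g₀) kr shA K t u)
      (fun K t u => weightBK₁₃ θ hP K₀ g₀ os kr K t u - classVal (classSet₁₃ θ K₀ g₀) kr shB K t u) δ := by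
  letI iS : DecidableEq (Σ K, SiteSeqKey F (K₀ + K)) := Classical.decEq _
  -- the descent along `kr`, all at the instance `iS`
  have hdesc := core_classVal (T := classSetK₁₃ θ K₀ g₀ kr) (Bad := badClassK₁₃ θ K₀ g₀ kr bd) (π := kr) h
    (fun K t ht x hx hbad => (mem_badClassK₁₃_iff θ K₀ g₀ kr bd K t (kr K x)).2 ⟨kr_mem_classSetK₁₃ θ K₀ g₀ kr hx, hcover K t ht x hx hbad⟩)
  rw [classVal_sub_fun, classVal_sub_fun] at hdesc
  -- `weightAK₁₃` is `classVal … weightA₁₃` at the Sigma-derived instance (dag-n20-d's `weightAK₁₃_eq_classVal_record`, `rfl`); bridge the instances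
  have hA : classVal (classSet₁₃ θ K₀ g₀) kr (weightA₁₃ θ hP K₀ g₀ os) = weightAK₁₃ θ hP K₀ g₀ os kr := by
    funext K t u
    rw [weightAK₁₃_eq_classVal_record]
    exact congrFun (congrFun (congrFun (classVal_congr_decEq _ _ _ _ _) K) t) u
  have hB : classVal (classSet₁₃ θ K₀ g₀) kr (weightB₁₃ θ hP K₀ g₀ os) = weightBK₁₃ θ hP K₀ g₀ os kr := by
    funext K t u
    rw [weightBK₁₃_eq_classVal_record]
    exact congrFun (congrFun (congrFun (classVal_congr_decEq _ _ _ _ _) K) t) u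
  simpa only [hA, hB] using hdesc

/-- The ∃δ form (the N19′ currency `∃ δ, Core … δ ∧ Summable δ`). [bookkeeping] -/
theorem coreEdge_keyReading_of_coreEdge_record (shA shB : ℕ → ℝ → (Σ K, SiteSeqKey F (K₀ + K)) → ℝ)
    (h : letI : DecidableEq (Σ K, SiteSeqKey F (K₀ + K)) := Classical.decEq _
      ∃ δ : ℕ → ℝ, Core 1 ((F.side : ℝ) ^ 4) (classSet₁₃ θ K₀ g₀) (badClass₁₃ θ K₀ g₀ jcut)
        (fun K t x => weightA₁₃ θ hP K₀ g₀ os K t x - shA K t x) (fun K t x => weightB₁₃ θ hP K₀ g₀ os K t x - shB K t x) δ ∧ Summable δ)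
    (hcover : ∀ (K : ℕ) (t : ℝ), |t| ≤ 1 → ∀ x ∈ classSet₁₃ θ K₀ g₀ K, x ∈ badClass₁₃ θ K₀ g₀ jcut K t → bd K (kr K x)) :
    letI : DecidableEq (Σ K, SiteSeqKey F (K₀ + K)) := Classical.decEq _
    ∃ δ : ℕ → ℝ, Core 1 ((F.side : ℝ) ^ 4) (classSetK₁₃ θ K₀ g₀ kr) (badClassK₁₃ θ K₀ g₀ kr bd)
      (fun K t u => weightAK₁₃ θ hP K₀ g₀ os kr K t u - classVal (classSet₁₃ θ K₀ g₀) kr shA K t u)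
      (fun K t u => weightBK₁₃ θ hP K₀ g₀ os kr K t u - classVal (classSet₁₃ θ K₀ g₀) kr shB K t u) δ ∧ Summable δ := by
  obtain ⟨δ, hC, hδ⟩ := h
  exact ⟨δ, core_keyReading_of_core_record θ hP K₀ g₀ os kr bd jcut shA shB hC hcover, hδ⟩

end Descent

/-! ## §3 The cover condition: two instances and one located non-instance [bookkeeping] -/

section Cover
variable {F : T4Family} {N : ℕ} [NeZero N] (θ : Stage13HParams F N) (K₀ : ℕ) (g₀ : ℕ → ℝ)
  (kr : ℕ → (Σ K, SiteSeqKey F (K₀ + K)) → (Σ K, SiteSeqKey F (K₀ + K))) (jcut : ℕ → ℕ)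

/-- **★ THE IMAGE FLAG ALWAYS COVERS** [bookkeeping]: reading the bad class at the coarse key as «the image of the record's bad class» — `bd K u := ∃ x ∈ badClass₁₃ … jcut K 0, kr K x = u`
(`badClass₁₃` does not read its source argument) — the cover condition of §2 holds for every dial. -/
theorem cover_imageFlag :
    ∀ (K : ℕ) (t : ℝ), |t| ≤ 1 → ∀ x ∈ classSet₁₃ θ K₀ g₀ K, x ∈ badClass₁₃ θ K₀ g₀ jcut K t →
      (fun K u => ∃ x ∈ badClass₁₃ θ K₀ g₀ jcut K 0, kr K x = u) K (kr K x) :=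
  fun _ _ _ x _ hbad => ⟨x, hbad, rfl⟩

/-- **★ IN THE POLICY-WALL REGIME EVERY FLAG COVERS** [bookkeeping]: with the zero policy the record's bad class is empty (NODE 00's `not_keyOldLargeField_zero`), so §2's cover condition
is vacuous for every dial and every bad-key reading — the regime dag-n20-w1's policy wall forces under first-level saturation. -/
theorem cover_of_cutZero (bd : ℕ → (Σ K, SiteSeqKey F (K₀ + K)) → Prop) :
    ∀ (K : ℕ) (t : ℝ), |t| ≤ 1 → ∀ x ∈ classSet₁₃ θ K₀ g₀ K, x ∈ badClass₁₃ θ K₀ g₀ (fun _ => 0) K t → bd K (kr K x) := by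
  intro K t _ x _ hbad
  obtain ⟨-, hold⟩ := (mem_badKeysSigma_iff F _ (fun _ => 0) x).1 hbad
  exact absurd hold (not_keyOldLargeField_zero x.2)

/-- **★★ THE LOCATED NON-INSTANCE: WINDOW DIAL + PERSISTENCE FLAG BELOW THE FLOOR** [bookkeeping].  With the window dial `windowKeySigma F c` and the persistence flag
`bd K u := KeyOldLargeField (jcut u.1) u.2` at a policy `jcut K ≤ c K`, the cover condition of §2 FAILS at step `K` as soon as ONE class of record at step `K` carries an old large
field at a level `≤ jcut K`: the window kills it (dag-n20-d's `not_keyOldLargeField_windowKey` BY NAME).  So the v5 face does NOT transport to «window key + persistence flag below the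
floor»; the window-keyed N19′ with that flag is a different stub (its room = the absorption of p610409 ∕ p613310). -/
theorem not_cover_window_persistence (c : ℕ → ℕ) {K : ℕ} (hle : jcut K ≤ c K) (t : ℝ) (ht : |t| ≤ 1)
    (hex : ∃ x ∈ classSet₁₃ θ K₀ g₀ K, x ∈ badClass₁₃ θ K₀ g₀ jcut K t) :
    ¬ ∀ (K : ℕ) (t : ℝ), |t| ≤ 1 → ∀ x ∈ classSet₁₃ θ K₀ g₀ K, x ∈ badClass₁₃ θ K₀ g₀ jcut K t →
      (fun (_ : ℕ) (u : Σ K, SiteSeqKey F (K₀ + K)) => KeyOldLargeField (jcut u.1) u.2) K (windowKeySigma F c x) := by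
  intro hcov
  obtain ⟨x, hx, hbad⟩ := hex
  have hK : x.1 = K := by
    obtain ⟨hxT, -⟩ := (mem_badKeysSigma_iff F _ jcut x).1 hbad
    -- every element of `classSet₁₃ … K` has first component `K` (both keyed images are `⟨K, _⟩`)
    simp only [classSet₁₃, Finset.mem_union, Finset.mem_image, Finset.mem_univ, true_and] at hxT
    rcases hxT with ⟨s, rfl⟩ | ⟨s, rfl⟩
    · rfl
    · unfold keyB₁₃; split_ifs <;> rfl
  have h := hcov K t ht x hx hbad
  simp only [windowKeySigma_fst, windowKeySigma_snd] at h
  have hle' : jcut x.1 ≤ c x.1 := by rw [hK]; exact hle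
  exact not_keyOldLargeField_windowKey hle' x.2 h

end Cover

/-! ## §4 At the reading, zero shells: the v5 face implies the key-reading face with ITS canonical rate [bookkeeping] -/

section AtReading
variable {F : T4Family} {N : ℕ} [NeZero N] (K₀ : ℕ) (kr : KeyReading₁₃ N K₀) (bd : BadKeyReading₁₃ N K₀) (θ : Stage13HParams F N) (hP : θ.Provisos₁₃CoPH F N)
  (g₀ : ℕ → ℝ) (os : List (ULoop F)) (jcut : ℕ → ℕ)

/-- **★★ THE N19′ FACE-SHAPE AT `crOfRecord₁₃KAt K₀ kr bd 0` FROM A v5-PIN WITNESS** [bookkeeping].  If at the tuple the record's full key carries SOME summable `δ` with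
`Core 1 (F.side^4) classSet₁₃ (badClass₁₃ jcut) weightA₁₃ weightB₁₃ δ` (zero shells — the N19′ ∧ N20 policy of the window road), the dial's bad-key reading covers the policy, and run A's
class weights of record are non-negative (n20-w2's `weightA₁₃_nonneg` supplies it from `hP`), then at dag-n20-d's reading with that dial, that bad-key reading and the ZERO shell split the
N19′ face holds in the reading's OWN currency: `Core` at its carriers with its canonical `δ`, and that `δ` is summable (dag-n20-d's `core_crOfRecord₁₃KAt` BY NAME). -/
theorem coreEdge_crOfRecord₁₃KAt_zeroShell_of_record
    (h : letI : DecidableEq (Σ K, SiteSeqKey F (K₀ + K)) := Classical.decEq _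
      ∃ δ : ℕ → ℝ, Core 1 ((F.side : ℝ) ^ 4) (classSet₁₃ θ K₀ g₀) (badClass₁₃ θ K₀ g₀ jcut)
        (weightA₁₃ θ hP K₀ g₀ os) (weightB₁₃ θ hP K₀ g₀ os) δ ∧ Summable δ)
    (hcover : ∀ (K : ℕ) (t : ℝ), |t| ≤ 1 → ∀ x ∈ classSet₁₃ θ K₀ g₀ K, x ∈ badClass₁₃ θ K₀ g₀ jcut K t → bd F θ hP g₀ os K (kr F θ hP g₀ os K x))
    (hA0 : ∀ (K : ℕ) (t : ℝ), |t| ≤ 1 → ∀ x ∈ classSet₁₃ θ K₀ g₀ K, 0 ≤ weightA₁₃ θ hP K₀ g₀ os K t x) :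
    let cr := crOfRecord₁₃KAt K₀ kr bd (fun _ _ _ _ _ => (fun _ _ _ => 0, fun _ _ _ => 0)) F θ hP g₀ os
    (letI := cr.dec
     Core cr.l₀ cr.vol cr.T cr.Bad (fun K t τ => cr.A K t τ - cr.shA K t τ) (fun K t τ => cr.B K t τ - cr.shB K t τ) cr.δ) ∧ Summable cr.δ := by
  letI iS : DecidableEq (Σ K, SiteSeqKey F (K₀ + K)) := Classical.decEq _
  obtain ⟨δ, hC, hδ⟩ := h
  -- descend (shells zero on both sides)
  have hC0 : Core 1 ((F.side : ℝ) ^ 4) (classSet₁₃ θ K₀ g₀) (badClass₁₃ θ K₀ g₀ jcut)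
      (fun K t x => weightA₁₃ θ hP K₀ g₀ os K t x - (fun _ _ _ => (0 : ℝ)) K t x)
      (fun K t x => weightB₁₃ θ hP K₀ g₀ os K t x - (fun _ _ _ => (0 : ℝ)) K t x) δ := by
    simpa only [sub_zero] using hC
  have hdesc := core_keyReading_of_core_record θ hP K₀ g₀ os (kr F θ hP g₀ os) (bd F θ hP g₀ os) jcut _ _ hC0 hcover
  simp only [classVal_zero] at hdesc
  -- non-negativity of the coarse cores (fibre sums of non-negative class weights)
  have hP0 : ∀ (K : ℕ) (t : ℝ), |t| ≤ 1 → ∀ u ∈ classSetK₁₃ θ K₀ g₀ (kr F θ hP g₀ os) K \ badClassK₁₃ θ K₀ g₀ (kr F θ hP g₀ os) (bd F θ hP g₀ os) K t,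
      0 ≤ weightAK₁₃ θ hP K₀ g₀ os (kr F θ hP g₀ os) K t u - (0 : ℝ) := fun K t ht u _ => by
    rw [sub_zero]
    exact weightAK₁₃_nonneg θ hP K₀ g₀ os (kr F θ hP g₀ os) (hA0 K t ht) u
  exact core_crOfRecord₁₃KAt K₀ kr bd _ θ hP g₀ os hP0 hdesc hδ

/-- **★ THE SAME AT THE LEVEL-WINDOW DIAL OF RECORD WITH THE IMAGE FLAG** [bookkeeping]: `kr := windowKeyReading₁₃ K₀ c` (dag-n20-d's window VALUE of the dial, floor reading `c`)
and the bad-key reading «image of the record's policy-`jc` class under the window» — the cover is `cover_imageFlag`, so a v5-pin witness at policy `jc` transports to the window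
reading with that flag (zero shells), canonical `δ` summable.  (With the PERSISTENCE flag below the floor instead, §3's `not_cover_window_persistence` applies: no transport.) -/
theorem coreEdge_windowReading_imageFlag_of_record (c jc : FloorReading₁₃ N)
    (h : letI : DecidableEq (Σ K, SiteSeqKey F (K₀ + K)) := Classical.decEq _
      ∃ δ : ℕ → ℝ, Core 1 ((F.side : ℝ) ^ 4) (classSet₁₃ θ K₀ g₀) (badClass₁₃ θ K₀ g₀ (jc F θ hP g₀ os))
        (weightA₁₃ θ hP K₀ g₀ os) (weightB₁₃ θ hP K₀ g₀ os) δ ∧ Summable δ)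
    (hA0 : ∀ (K : ℕ) (t : ℝ), |t| ≤ 1 → ∀ x ∈ classSet₁₃ θ K₀ g₀ K, 0 ≤ weightA₁₃ θ hP K₀ g₀ os K t x) :
    let cr := crOfRecord₁₃KAt K₀ (windowKeyReading₁₃ K₀ c)
      (fun F θ hP g₀ os K u => ∃ x ∈ badClass₁₃ θ K₀ g₀ (jc F θ hP g₀ os) K 0, windowKeySigma F (c F θ hP g₀ os) x = u)
      (fun _ _ _ _ _ => (fun _ _ _ => 0, fun _ _ _ => 0)) F θ hP g₀ os
    (letI := cr.dec
     Core cr.l₀ cr.vol cr.T cr.Bad (fun K t τ => cr.A K t τ - cr.shA K t τ) (fun K t τ => cr.B K t τ - cr.shB K t τ) cr.δ) ∧ Summable cr.δ :=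
  coreEdge_crOfRecord₁₃KAt_zeroShell_of_record K₀ (windowKeyReading₁₃ K₀ c) _ θ hP g₀ os (jc F θ hP g₀ os) h
    (cover_imageFlag θ K₀ g₀ (fun _ x => windowKeySigma F (c F θ hP g₀ os) x) (jc F θ hP g₀ os)) hA0

end AtReading

end Summit.QuantumFields.YangMills.BalabanUVNodes.N19WindowTruncationKey
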